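import Summits.QuantumFields.QCD.Theses.SpectralDefectExtinction
import Summits.QuantumFields.QCD.Theorems.SpectralDefectExtinctionPositivityDeficitLeDefectsRootCount
import Literature.MathematicalPhysics.QuantumFieldTheory.QCDPhaseQuenched
import Literature.MathematicalPhysics.QuantumLattice.WilsonDiracAP

/-!
# Stub `stub_signHalfOfExtinct` of line `block-away-the-sign`
(crux `Summit.QuantumFields.QCD.Theses.SpectralDefectExtinction.ExtinctionBuildsQCD`, item stmt-QuantumFields-18064)

The sign half of EXTINCT at the scheme's own torus side `S = L_k`: if for every `ε > 0`, eventually in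
`k`, on every torus `S ≥ L_k` the phase-quenched expectation of `Σ_f (#sign defects_f + #window defects_f)`
is `≤ ε ((2S+1)/(2L_k+1))⁴`, then at `S = L_k` the phase-quenched expectation of `Σ_f #sign defects_f`
alone is eventually `≤ ε`.  Proof: instantiate `S = L_k` (volume factor `1`) and drop the non-negative
window summand — monotonicity of the Bochner integral of non-negative integrands against the weight
`∏_f |det D_W(U, m_f(k), 1)|`, which needs the INTEGRABILITY of the full EXTINCT integrand: the two
spectral counts are Borel measurable in the gauge field (superlevel sets are countable unions of the closed
superlevel sets of counts in closed sets, tree `isClosed_le_countP_charpoly_roots` /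
`measurable_countP_charpoly_roots_real_lt`), bounded by the matrix size, and the weight is continuous on the
compact configuration space (`integrable_norm_det_diracMatrix`), for every finite measure.

The general helpers are adapted (with attribution; the source modules are not importable here) from
`Summits/QuantumFields/QCD/Theorems/SpectralDefectExtinctionTipPricingStubCountMeasurable.lean` and
`Summits/QuantumFields/QCD/Theorems/ExtinctionBuildsQCD/Negative/ExtinctIntegrable.lean`.
-/

noncomputable section

namespace Summit.QuantumFields.QCD.Cruxes.ExtinctionBuildsQCD.BlockAwayTheSign

open scoped BigOperators Topology Classical MeasureTheory Matrix
open Filter MeasureTheory Matrix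
open Literature.MathematicalPhysics.QuantumLattice Literature.MathematicalPhysics.AQFT
  Literature.MathematicalPhysics.QuantumFieldTheory
open Summit.QuantumFields.QCD.Theses.SpectralDefectExtinction
open Summit.QuantumFields.QCD.Theses
open Summit.QuantumFields.QCD.Theorems.PositivityDeficitLeDefects
  (isClosed_le_countP_charpoly_roots measurable_of_measurableSet_le measurable_countP_charpoly_roots_real_lt)

/-! ## Measurability of spectral counts of a continuous matrix family -/

section CountMeasurable

variable {n : Type*} [Fintype n] [DecidableEq n]

-- adapted from Summits/QuantumFields/QCD/Theorems/SpectralDefectExtinctionTipPricingStubCountMeasurable.lean:countMeas_le_countP_iff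
/-- Counting in an increasing countable union `{P} = ⋃ⱼ F j` over a (finite) multiset: at least `m` elements
satisfy `P` iff at least `m` elements lie in some `F j`. -/
theorem signHalf_le_countP_iff {α : Type*} (s : Multiset α) (P : α → Prop) [DecidablePred P]
    (F : ℕ → Set α) [∀ j, DecidablePred (· ∈ F j)] (hmono : Monotone F) (hPF : ∀ a, P a ↔ ∃ j, a ∈ F j)
    (m : ℕ) : m ≤ s.countP P ↔ ∃ j, m ≤ s.countP (· ∈ F j) := by
  have hJ : ∃ J, ∀ a ∈ s, P a → a ∈ F J := by
    induction s using Multiset.induction_on with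
    | empty => exact ⟨0, fun a ha _ => absurd ha (Multiset.notMem_zero a)⟩
    | cons b s ih =>
      obtain ⟨J₀, hJ₀⟩ := ih
      by_cases hb : P b
      · obtain ⟨j, hj⟩ := (hPF b).mp hb
        refine ⟨max J₀ j, fun a ha hPa => ?_⟩
        rcases Multiset.mem_cons.mp ha with rfl | ha
        · exact hmono (le_max_right _ _) hj
        · exact hmono (le_max_left _ _) (hJ₀ a ha hPa)
      · refine ⟨J₀, fun a ha hPa => ?_⟩
        rcases Multiset.mem_cons.mp ha with rfl | ha
        · exact absurd hPa hb
        · exact hJ₀ a ha hPa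
  obtain ⟨J, hJ⟩ := hJ
  constructor
  · intro hm
    exact ⟨J, hm.trans_eq (Multiset.countP_congr rfl fun a ha =>
      propext ⟨hJ a ha, fun h => (hPF a).mpr ⟨J, h⟩⟩)⟩
  · rintro ⟨j, hj⟩
    refine hj.trans ?_
    rw [Multiset.countP_eq_card_filter, Multiset.countP_eq_card_filter]
    exact Multiset.card_le_card (Multiset.monotone_filter_right s fun a ha => (hPF a).mpr ⟨j, ha⟩)

variable {X : Type*} [TopologicalSpace X] [SequentialSpace X] [MeasurableSpace X] [OpensMeasurableSpace X]
  {A : X → Matrix n n ℂ}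

-- adapted from Summits/QuantumFields/QCD/Theorems/SpectralDefectExtinctionTipPricingStubCountMeasurable.lean:countMeas_measurable_countP
-- (the closedness of the superlevel sets is the tree's `isClosed_le_countP_charpoly_roots`)
/-- **Measurability of spectral counts.** For a continuous matrix family `A` on a sequential space whose
σ-algebra contains the open sets, and a predicate `P` on `ℂ` whose truth set is an increasing countable union
of closed sets `F j`, the count `x ↦ #{roots of charpoly (A x) satisfying P}` (with multiplicity) is
measurable: its superlevel sets are countable unions of the closed superlevel sets of the `F j`-counts. -/
theorem signHalf_measurable_countP_of_exhaustion (hA : Continuous A) (P : ℂ → Prop) [DecidablePred P]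
    (F : ℕ → Set ℂ) [∀ j, DecidablePred (· ∈ F j)] (hF : ∀ j, IsClosed (F j)) (hmono : Monotone F)
    (hPF : ∀ a, P a ↔ ∃ j, a ∈ F j) : Measurable fun x => (A x).charpoly.roots.countP P := by
  refine measurable_of_measurableSet_le fun m => ?_
  have hset : {x | m ≤ (A x).charpoly.roots.countP P} =
      ⋃ j, {x | m ≤ (A x).charpoly.roots.countP (· ∈ F j)} := by
    ext x
    simp only [Set.mem_setOf_eq, Set.mem_iUnion]
    exact signHalf_le_countP_iff _ P F hmono hPF m
  rw [hset]
  exact MeasurableSet.iUnion fun j => (isClosed_le_countP_charpoly_roots hA (hF j) m).measurableSet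

/-- `1/(k+1) ≤ 1/(j+1)` for `j ≤ k` (monotonicity of the closed exhaustion below). -/
theorem signHalf_one_div_succ_anti {j k : ℕ} (h : j ≤ k) : (1 : ℝ) / (k + 1) ≤ 1 / (j + 1) :=
  one_div_le_one_div_of_le (by positivity) (by exact_mod_cast Nat.succ_le_succ h)

/-- **Measurability of the open-strip count.** For a continuous matrix family `A` on a sequential space
whose σ-algebra contains the open sets, the number (with multiplicity) of eigenvalues of `A x` in the open
strip `{|Re z| < η}` is a measurable function of `x`: the strip is exhausted by the closed strips
`{|Re z| ≤ η − 1/(j+1)}` (the `|Re| < η` analogue of the tree's `measurable_countP_charpoly_roots_real_lt`). -/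
theorem signHalf_measurable_countP_charpoly_roots_abs_re_lt (hA : Continuous A) (η : ℝ) :
    Measurable fun x => (A x).charpoly.roots.countP fun z => |z.re| < η := by
  refine signHalf_measurable_countP_of_exhaustion hA (fun z : ℂ => |z.re| < η)
    (fun j => {z : ℂ | |z.re| ≤ η - 1 / (j + 1)}) (fun j => ?_) (fun j k hjk => ?_) (fun z => ?_)
  · exact isClosed_le (continuous_abs.comp Complex.continuous_re) continuous_const
  · intro z hz
    simp only [Set.mem_setOf_eq] at hz ⊢
    linarith [signHalf_one_div_succ_anti hjk]
  · constructor
    · intro h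
      obtain ⟨j, hj⟩ := exists_nat_one_div_lt (sub_pos.mpr h)
      exact ⟨j, by simp only [Set.mem_setOf_eq]; linarith⟩
    · rintro ⟨j, hj⟩
      simp only [Set.mem_setOf_eq] at hj
      have : (0 : ℝ) < 1 / (j + 1) := by positivity
      linarith

/-- A root count of a characteristic polynomial (over a domain) is at most the matrix size. -/
theorem signHalf_countP_roots_charpoly_le_card {R : Type*} [CommRing R] [IsDomain R]
    (M : Matrix n n R) (p : R → Prop) [DecidablePred p] :
    Multiset.countP p M.charpoly.roots ≤ Fintype.card n :=
  ((Multiset.countP_le_card _ _).trans (Polynomial.card_roots' _)).trans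
    (le_of_eq (Matrix.charpoly_natDegree_eq_dim M))

end CountMeasurable

/-! ## Integrability of the EXTINCT integrand against a finite measure on configurations -/

section Integrable

variable {L : ℕ} [NeZero L] {Nf : ℕ}

-- adapted from Summits/QuantumFields/QCD/Theorems/ExtinctionBuildsQCD/Negative/ExtinctIntegrable.lean:integrable_mul_weight
-- (there for the Wilson measure; here for every finite measure on the configuration space)
/-- **A bounded measurable functional times the phase-quenched weight is integrable** against every finite
measure on the configuration space (the weight `∏_f |det D_W(U, m_f, 1)| = |det D(U)|` is continuous on the
compact configuration space, `integrable_norm_det_diracMatrix`). -/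
theorem signHalf_integrable_mul_weight (mq : Fin Nf → ℝ) (μ : Measure (GaugeConfig 4 L SU3))
    [IsFiniteMeasure μ] {φ : GaugeConfig 4 L SU3 → ℝ} (hφ : Measurable φ) {C : ℝ} (hC : ∀ U, |φ U| ≤ C) :
    Integrable (fun U => φ U * ∏ f : Fin Nf, ‖fermionDet (wilsonDirac (fundamentalRep (Fin 3)) U (mq f) 1)‖)
      μ := by
  obtain ⟨CW, hCW⟩ := exists_norm_det_diracMatrix_le (S := L) mq
  have hW : ∀ U : GaugeConfig 4 L SU3,
      (∏ f : Fin Nf, ‖fermionDet (wilsonDirac (fundamentalRep (Fin 3)) U (mq f) 1)‖) =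
        ‖(diracMatrix U mq).det‖ := fun U => (norm_det_diracMatrix U mq).symm
  simp_rw [hW]
  refine Integrable.of_bound (hφ.aestronglyMeasurable.mul
    (measurable_norm_det_diracMatrix mq).aestronglyMeasurable) (C * CW)
    (Eventually.of_forall fun U => ?_)
  rw [norm_mul, Real.norm_eq_abs, Real.norm_eq_abs, abs_of_nonneg (norm_nonneg _)]
  have hC0 : 0 ≤ C := (abs_nonneg _).trans (hC U)
  exact mul_le_mul (hC U) (hCW U) (norm_nonneg _) hC0

-- adapted from Summits/QuantumFields/QCD/Theorems/ExtinctionBuildsQCD/Negative/ExtinctIntegrable.lean:integrable_extinctIntegrand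
-- (there for the Wilson measure; here for every finite measure on the configuration space)
/-- **The EXTINCT integrand is integrable** (witness data `(reg, c)`, step `k`, tuple `m`, any torus, any
finite measure on configurations): finitely many measurable spectral counts — the sign count by the tree's
`measurable_countP_charpoly_roots_real_lt` for the continuous family `U ↦ D_W(U,0,1)`, the window count by
`signHalf_measurable_countP_charpoly_roots_abs_re_lt` for `U ↦ Γ₅ D_W(U, m_f(k), 1)` — each bounded by the
matrix size `12·L⁴`, times the continuous weight. -/
theorem signHalf_integrable_extinctIntegrand (reg : QCDRegularisation Nf) (c : ℝ) (k : ℕ)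
    (m : Fin Nf → ℝ) (μ : Measure (GaugeConfig 4 L SU3)) [IsFiniteMeasure μ] :
    Integrable (fun U : GaugeConfig 4 L SU3 => (∑ f : Fin Nf, ((Multiset.countP (fun z : ℂ => z.im = 0 ∧ z.re < -(reg.mcrit k + reg.a k * m f / reg.Zm k)) (wilsonDirac (fundamentalRep (Fin 3)) U 0 1).charpoly.roots : ℝ) + (Multiset.countP (fun z : ℂ => |z.re| < c * (reg.a k * m f / reg.Zm k)) (spinorLift gammaFive * wilsonDirac (fundamentalRep (Fin 3)) U (reg.mcrit k + reg.a k * m f / reg.Zm k) 1).charpoly.roots : ℝ))) * ∏ f : Fin Nf, ‖fermionDet (wilsonDirac (fundamentalRep (Fin 3)) U (reg.mcrit k + reg.a k * m f / reg.Zm k) 1)‖)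
      μ := by
  have hρ := continuous_fundamentalRep (Fin 3)
  refine signHalf_integrable_mul_weight (fun f => reg.mcrit k + reg.a k * m f / reg.Zm k) μ
    (Finset.measurable_sum _ fun f _ => ?_) (C := ∑ _f : Fin Nf, ((Fintype.card (QuarkIdx L) : ℝ) +
      Fintype.card (QuarkIdx L))) (fun U => ?_)
  · have hc : ∀ g : GaugeConfig 4 L SU3 → ℕ, Measurable g → Measurable fun U => (g U : ℝ) :=
      fun g hg => measurable_from_nat.comp hg
    refine (hc _ (measurable_countP_charpoly_roots_real_lt
      (continuous_wilsonDirac (L := L) (fundamentalRep (Fin 3)) hρ 0 1) _)).add (hc _ ?_)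
    exact signHalf_measurable_countP_charpoly_roots_abs_re_lt
      (continuous_const.matrix_mul (continuous_wilsonDirac (L := L) (fundamentalRep (Fin 3)) hρ _ 1)) _
  · rw [abs_of_nonneg (Finset.sum_nonneg fun f _ => by positivity)]
    refine Finset.sum_le_sum fun f _ => add_le_add ?_ ?_
    · exact_mod_cast signHalf_countP_roots_charpoly_le_card _ _
    · exact_mod_cast signHalf_countP_roots_charpoly_le_card _ _

end Integrable

/-! ## The stub -/

/-- **Stub E — the sign half of EXTINCT at the scheme's own side (projection; provable now).** If EXTINCT holds for
the witness data `(reg, c)` at the tuple `m` (all tori `S ≥ L_k`, sign + window counts), then at `S = L_k` the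
phase-quenched expected number of real eigenvalues of `D_W(U,0,1)` below every `−m_f(k)` is eventually `≤ ε`:
instantiate `S = L_k` (volume ratio `1`) and drop the non-negative window summand (integrals of non-negative
integrands against the `|det|`-weight are monotone; both integrands are integrable: counts are bounded by
`12(2S+1)⁴` per flavour — a `charpoly` of a `12(2S+1)⁴`-dimensional matrix has that many roots — and
`∏_f ‖det‖` is continuous on a compact configuration space). [MontvayMunster1994 §5.1; folklore] -/
theorem stub_signHalfOfExtinct :
    ∀ {Nf : ℕ} (reg : QCDRegularisation Nf) (c : ℝ) (m : Fin Nf → ℝ),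
      (∀ ε : ℝ, 0 < ε → ∀ᶠ k : ℕ in Filter.atTop, ∀ S : ℕ, reg.L k ≤ S →
        (∫ (U : GaugeConfig 4 (2 * S + 1) SU3), ((∑ f : Fin Nf, ((Multiset.countP (fun z : ℂ => z.im = 0 ∧ z.re < -(reg.mcrit k + reg.a k * m f / reg.Zm k)) (wilsonDirac (fundamentalRep (Fin 3)) U 0 1).charpoly.roots : ℝ) + (Multiset.countP (fun z : ℂ => |z.re| < c * (reg.a k * m f / reg.Zm k)) (spinorLift gammaFive * wilsonDirac (fundamentalRep (Fin 3)) U (reg.mcrit k + reg.a k * m f / reg.Zm k) 1).charpoly.roots : ℝ)))) * ∏ f : Fin Nf, ‖fermionDet (wilsonDirac (fundamentalRep (Fin 3)) U (reg.mcrit k + reg.a k * m f / reg.Zm k) 1)‖ ∂(wilsonMeasure (fundamentalRep (Fin 3)) (reg.β k))) / (∫ (U : GaugeConfig 4 (2 * S + 1) SU3), ∏ f : Fin Nf, ‖fermionDet (wilsonDirac (fundamentalRep (Fin 3)) U (reg.mcrit k + reg.a k * m f / reg.Zm k) 1)‖ ∂(wilsonMeasure (fundamentalRep (Fin 3)) (reg.β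 k))) ≤ ε * ((2 * S + 1 : ℝ) / (2 * reg.L k + 1)) ^ 4) →
      ∀ ε : ℝ, 0 < ε → ∀ᶠ k : ℕ in Filter.atTop,
        (∫ (U : GaugeConfig 4 (2 * reg.L k + 1) SU3), (∑ f : Fin Nf, (Multiset.countP (fun z : ℂ => z.im = 0 ∧ z.re < -(reg.mcrit k + reg.a k * m f / reg.Zm k)) (wilsonDirac (fundamentalRep (Fin 3)) U 0 1).charpoly.roots : ℝ)) * ∏ f : Fin Nf, ‖fermionDet (wilsonDirac (fundamentalRep (Fin 3)) U (reg.mcrit k + reg.a k * m f / reg.Zm k) 1)‖ ∂(wilsonMeasure (fundamentalRep (Fin 3)) (reg.β k))) / (∫ (U : GaugeConfig 4 (2 * reg.L k + 1) SU3), ∏ f : Fin Nf, ‖fermionDet (wilsonDirac (fundamentalRep (Fin 3)) U (reg.mcrit k + reg.a k * m f / reg.Zm k) 1)‖ ∂(wilsonMeasure (fundamentalRep (Fin 3)) (reg.β k))) ≤ ε := by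
  intro Nf reg c m hExt ε hε
  filter_upwards [hExt ε hε] with k hk
  -- instantiate the scheme's own side `S = L_k`: the volume factor is `1`
  have hk' := hk (reg.L k) le_rfl
  have hone : ((2 * ((reg.L k : ℕ) : ℝ) + 1) / (2 * reg.L k + 1) : ℝ) = 1 := div_self (by positivity)
  rw [hone, one_pow, mul_one] at hk'
  refine le_trans ?_ hk'
  -- drop the non-negative window summand: monotonicity of the numerator, common denominator `≥ 0`
  refine div_le_div_of_nonneg_right ?_
    (integral_nonneg fun U => Finset.prod_nonneg fun f _ => norm_nonneg _)
  refine integral_mono_of_nonneg (Eventually.of_forall fun U => ?_)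
    (signHalf_integrable_extinctIntegrand reg c k m _) (Eventually.of_forall fun U => ?_)
  · exact mul_nonneg (Finset.sum_nonneg fun f _ => Nat.cast_nonneg _)
      (Finset.prod_nonneg fun f _ => norm_nonneg _)
  · refine mul_le_mul_of_nonneg_right (Finset.sum_le_sum fun f _ => ?_)
      (Finset.prod_nonneg fun f _ => norm_nonneg _)
    exact le_add_of_nonneg_right (Nat.cast_nonneg _)

end Summit.QuantumFields.QCD.Cruxes.ExtinctionBuildsQCD.BlockAwayTheSign

end
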